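import Mathlib.Analysis.Complex.Basic
import Mathlib.LinearAlgebra.Complex.Module
import Mathlib.LinearAlgebra.TensorProduct.Tower
import Mathlib.LinearAlgebra.TensorProduct.Prod
import Mathlib.LinearAlgebra.BilinearForm.TensorProduct
import Mathlib.Algebra.Ring.NegOnePow
import Mathlib.LinearAlgebra.Dimension.Finrank
import Mathlib.RingTheory.Flat.Basic
import Mathlib.Order.SupIndep
import Summits.Ventures.HodgeRepro2.HostAPI.Util.ForallBinderLint

open scoped TensorProduct

noncomputable section

namespace HostAPI.Carriers.AlgebraicGeometry.Motives

universe u v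

variable {V : Type u} [AddCommGroup V] [Module ℚ V]
variable {W : Type v} [AddCommGroup W] [Module ℚ W]

namespace HodgeStructure

def conj : ℂ ⊗[ℚ] V →ₗ[ℚ] ℂ ⊗[ℚ] V :=
  (Complex.conjAe.toLinearMap.restrictScalars ℚ).rTensor V

@[simp]
theorem conj_tmul (c : ℂ) (v : V) : conj (c ⊗ₜ[ℚ] v) = (starRingEnd ℂ c) ⊗ₜ[ℚ] v := rfl

theorem conj_smul (c : ℂ) (x : ℂ ⊗[ℚ] V) : conj (c • x) = starRingEnd ℂ c • conj x := by
  induction x using TensorProduct.induction_on with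
  | zero => simp
  | tmul a v => simp [TensorProduct.smul_tmul']
  | add x y hx hy => simp [smul_add, map_add, hx, hy]

@[simp]
theorem conj_conj (x : ℂ ⊗[ℚ] V) : conj (conj x) = x := by
  induction x using TensorProduct.induction_on with
  | zero => simp
  | tmul a v => simp
  | add x y hx hy => simp [map_add, hx, hy]

theorem conj_baseChange (f : V →ₗ[ℚ] W) (x : ℂ ⊗[ℚ] V) :
    conj (f.baseChange ℂ x) = f.baseChange ℂ (conj x) := by
  induction x using TensorProduct.induction_on with
  | zero => simp
  | tmul a v => simp
  | add x y hx hy => simp [map_add, hx, hy]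

def complexConj (W : Submodule ℂ (ℂ ⊗[ℚ] V)) : Submodule ℂ (ℂ ⊗[ℚ] V) where
  carrier := conj ⁻¹' W
  zero_mem' := by simp
  add_mem' {x y} hx hy := by
    simp only [Set.mem_preimage, SetLike.mem_coe, map_add] at hx hy ⊢
    exact W.add_mem hx hy
  smul_mem' c {x} hx := by
    simp only [Set.mem_preimage, SetLike.mem_coe] at hx ⊢
    rw [conj_smul]
    exact W.smul_mem _ hx

@[simp]
theorem mem_complexConj {W : Submodule ℂ (ℂ ⊗[ℚ] V)} {x : ℂ ⊗[ℚ] V} :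
    x ∈ complexConj W ↔ conj x ∈ W := Iff.rfl

@[simp]
theorem complexConj_complexConj (W : Submodule ℂ (ℂ ⊗[ℚ] V)) :
    complexConj (complexConj W) = W := by
  ext x; simp

theorem complexConj_mono {W₁ W₂ : Submodule ℂ (ℂ ⊗[ℚ] V)} (h : W₁ ≤ W₂) :
    complexConj W₁ ≤ complexConj W₂ := fun _ hx => h hx

@[simp]
theorem complexConj_top : complexConj (⊤ : Submodule ℂ (ℂ ⊗[ℚ] V)) = ⊤ := by
  ext x; simp

@[simp]
theorem complexConj_bot : complexConj (⊥ : Submodule ℂ (ℂ ⊗[ℚ] V)) = ⊥ := by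
  ext x
  simp only [mem_complexConj, Submodule.mem_bot]
  constructor
  · intro h; simpa using congrArg conj h
  · intro h; simp [h]

theorem complexConj_inf (W₁ W₂ : Submodule ℂ (ℂ ⊗[ℚ] V)) :
    complexConj (W₁ ⊓ W₂) = complexConj W₁ ⊓ complexConj W₂ := by
  ext x; simp

def complexConjOrderIso : Submodule ℂ (ℂ ⊗[ℚ] V) ≃o Submodule ℂ (ℂ ⊗[ℚ] V) where
  toFun := complexConj
  invFun := complexConj
  left_inv := complexConj_complexConj
  right_inv := complexConj_complexConj
  map_rel_iff' {W₁ W₂} := by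
    refine ⟨fun h => ?_, complexConj_mono⟩
    simpa using complexConj_mono (V := V) h

@[simp]
theorem complexConjOrderIso_apply (W : Submodule ℂ (ℂ ⊗[ℚ] V)) :
    complexConjOrderIso W = complexConj W := rfl

theorem complexConj_sup (W₁ W₂ : Submodule ℂ (ℂ ⊗[ℚ] V)) :
    complexConj (W₁ ⊔ W₂) = complexConj W₁ ⊔ complexConj W₂ :=
  complexConjOrderIso.map_sup W₁ W₂

theorem complexConj_comap_baseChange (f : V →ₗ[ℚ] W) (U : Submodule ℂ (ℂ ⊗[ℚ] W)) :
    complexConj (U.comap (f.baseChange ℂ)) = (complexConj U).comap (f.baseChange ℂ) := by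
  ext x; simp [conj_baseChange]

def ofRat : V →ₗ[ℚ] ℂ ⊗[ℚ] V := TensorProduct.mk ℚ ℂ V 1

@[simp]
theorem ofRat_apply (v : V) : ofRat v = (1 : ℂ) ⊗ₜ[ℚ] v := rfl

theorem conj_ofRat (v : V) : conj (ofRat v) = ofRat v := by simp

end HodgeStructure

@[ext]
structure HodgeStructure (V : Type u) [AddCommGroup V] [Module ℚ V] (n : ℤ) where

  F : ℤ → Submodule ℂ (ℂ ⊗[ℚ] V)

  antitone_F : Antitone F

  exists_F_eq_top : ∃ p, F p = ⊤

  exists_F_eq_bot : ∃ p, F p = ⊥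

  isCompl_F_complexConj : ∀ p q, p + q = n + 1 → IsCompl (F p) (HodgeStructure.complexConj (F q))

namespace HodgeStructure

variable {n : ℤ}

def piece (H : HodgeStructure V n) (p q : ℤ) : Submodule ℂ (ℂ ⊗[ℚ] V) :=
  if p + q = n then H.F p ⊓ complexConj (H.F q) else ⊥

@[simp]
theorem piece_of_add_eq (H : HodgeStructure V n) {p q : ℤ} (h : p + q = n) :
    H.piece p q = H.F p ⊓ complexConj (H.F q) := if_pos h

@[simp]
theorem piece_eq_bot_of_add_ne (H : HodgeStructure V n) {p q : ℤ} (h : p + q ≠ n) :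
    H.piece p q = ⊥ := if_neg h

theorem mem_piece_iff (H : HodgeStructure V n) {p q : ℤ} (h : p + q = n) {x : ℂ ⊗[ℚ] V} :
    x ∈ H.piece p q ↔ x ∈ H.F p ∧ conj x ∈ H.F q := by
  rw [piece_of_add_eq H h]
  rfl

theorem piece_le_F (H : HodgeStructure V n) (p q : ℤ) : H.piece p q ≤ H.F p := by
  unfold piece
  split_ifs
  exacts [inf_le_left, bot_le]

theorem piece_le_complexConj_F (H : HodgeStructure V n) (p q : ℤ) :
    H.piece p q ≤ complexConj (H.F q) := by
  unfold piece
  split_ifs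
  exacts [inf_le_right, bot_le]

theorem complexConj_piece (H : HodgeStructure V n) (p q : ℤ) :
    complexConj (H.piece p q) = H.piece q p := by
  unfold piece
  rw [add_comm q p]
  split_ifs
  · rw [complexConj_inf, complexConj_complexConj, inf_comm]
  · exact complexConj_bot

def iSupIndep_piece : Prop :=
  ∀ (H : HodgeStructure V n),
    iSupIndep fun p : ℤ => H.piece p (n - p)

def iSup_piece_eq_top : Prop :=
  ∀ (H : HodgeStructure V n),
    ⨆ p : ℤ, H.piece p (n - p) = ⊤

def F_eq_iSup_piece : Prop :=
  ∀ (H : HodgeStructure V n) (p : ℤ),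
    H.F p = ⨆ (i : ℤ) (_ : p ≤ i), H.piece i (n - i)

def hodgeNumber (H : HodgeStructure V n) (p q : ℤ) : ℕ :=
  Module.finrank ℂ (H.piece p q)

def hodgeNumber_symm : Prop :=
  ∀ (H : HodgeStructure V n) (p q : ℤ),
    H.hodgeNumber p q = H.hodgeNumber q p

theorem conj_mem_piece (H : HodgeStructure V n) {p q : ℤ} {x : ℂ ⊗[ℚ] V} (hx : x ∈ H.piece p q) :
    conj x ∈ H.piece q p := by
  rw [← mem_complexConj, complexConj_piece]
  exact hx

def conjPieceEquiv (H : HodgeStructure V n) (p q : ℤ) : H.piece p q ≃+ H.piece q p where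
  toFun x := ⟨conj x.1, conj_mem_piece H x.2⟩
  invFun x := ⟨conj x.1, conj_mem_piece H x.2⟩
  left_inv x := by ext; simp
  right_inv x := by ext; simp
  map_add' x y := by ext; simp [map_add]

@[simp]
theorem coe_conjPieceEquiv (H : HodgeStructure V n) (p q : ℤ) (x : H.piece p q) :
    (conjPieceEquiv H p q x : ℂ ⊗[ℚ] V) = conj x := rfl

theorem conjPieceEquiv_smul (H : HodgeStructure V n) (p q : ℤ) (c : ℂ) (x : H.piece p q) :
    conjPieceEquiv H p q (c • x) = starRingEnd ℂ c • conjPieceEquiv H p q x := by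
  ext
  simp [conj_smul]

theorem hodgeNumber_symm_holds : hodgeNumber_symm (V := V) (n := n) := by
  intro H p q
  unfold hodgeNumber Module.finrank
  rw [rank_eq_of_equiv_equiv (starRingEnd ℂ) (conjPieceEquiv H p q)
    (Function.Involutive.bijective fun c => starRingEnd_self_apply c) (conjPieceEquiv_smul H p q)]

def hodgeClasses (H : HodgeStructure V n) (p : ℤ) : Submodule ℚ V :=
  ((H.F p).restrictScalars ℚ).comap ofRat

theorem mem_hodgeClasses_iff (H : HodgeStructure V n) (p : ℤ) (v : V) :
    v ∈ H.hodgeClasses p ↔ ofRat v ∈ H.F p := Iff.rfl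

theorem ofRat_mem_piece_of_mem_hodgeClasses (H : HodgeStructure V n) {p : ℤ} (hn : p + p = n)
    {v : V} (hv : v ∈ H.hodgeClasses p) : ofRat v ∈ H.piece p p := by
  rw [mem_piece_iff H hn, conj_ofRat]
  exact ⟨hv, hv⟩

theorem hodgeNumber_eq_zero_of_add_ne (H : HodgeStructure V n) {p q : ℤ} (h : p + q ≠ n) :
    H.hodgeNumber p q = 0 := by
  rw [hodgeNumber, piece_eq_bot_of_add_ne H h, finrank_bot]

def level (H : HodgeStructure V n) : ℕ :=
  sSup {m : ℕ | ∃ p q : ℤ, p + q = n ∧ H.piece p q ≠ ⊥ ∧ m = (p - q).natAbs}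

def IsEffective (H : HodgeStructure V n) : Prop :=
  ∀ p q : ℤ, H.piece p q ≠ ⊥ → 0 ≤ p ∧ 0 ≤ q

@[ext]
structure Hom (H₁ : HodgeStructure V n) (H₂ : HodgeStructure W n) where

  toLinearMap : V →ₗ[ℚ] W

  map_F_le : ∀ p, (H₁.F p).map (toLinearMap.baseChange ℂ) ≤ H₂.F p

namespace Hom

def id (H : HodgeStructure V n) : Hom H H where
  toLinearMap := LinearMap.id
  map_F_le p := by simp [LinearMap.baseChange_id]

universe w in

def comp {U : Type w} [AddCommGroup U] [Module ℚ U] {H₁ : HodgeStructure V n}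
    {H₂ : HodgeStructure W n} {H₃ : HodgeStructure U n} (g : Hom H₂ H₃) (f : Hom H₁ H₂) :
    Hom H₁ H₃ where
  toLinearMap := g.toLinearMap ∘ₗ f.toLinearMap
  map_F_le p := by
    rw [LinearMap.baseChange_comp, Submodule.map_comp]
    exact (Submodule.map_mono (f.map_F_le p)).trans (g.map_F_le p)

def strict : Prop :=
  ∀ {H₁ : HodgeStructure V n} {H₂ : HodgeStructure W n} (f : Hom H₁ H₂) (p : ℤ),
    (H₁.F p).map (f.toLinearMap.baseChange ℂ) =
      H₂.F p ⊓ LinearMap.range (f.toLinearMap.baseChange ℂ)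

end Hom

structure SubHodgeStructure (H : HodgeStructure V n) where

  toSubmodule : Submodule ℚ V

  isCompl : ∀ p q, p + q = n + 1 →
    IsCompl ((H.F p).comap (toSubmodule.subtype.baseChange ℂ))
      ((complexConj (H.F q)).comap (toSubmodule.subtype.baseChange ℂ))

private theorem baseChange_injective {f : V →ₗ[ℚ] W} (hf : Function.Injective f) :
    Function.Injective (f.baseChange ℂ) := by
  rw [LinearMap.baseChange_eq_ltensor]
  exact Module.Flat.lTensor_preserves_injective_linearMap f hf

namespace SubHodgeStructure

variable {H : HodgeStructure V n}

def toHodgeStructure (S : SubHodgeStructure H) : HodgeStructure S.toSubmodule n where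
  F p := (H.F p).comap (S.toSubmodule.subtype.baseChange ℂ)
  antitone_F _ _ h := Submodule.comap_mono (H.antitone_F h)
  exists_F_eq_top := by
    obtain ⟨p, hp⟩ := H.exists_F_eq_top
    exact ⟨p, by simp [hp]⟩
  exists_F_eq_bot := by
    obtain ⟨p, hp⟩ := H.exists_F_eq_bot
    refine ⟨p, ?_⟩
    rw [hp, Submodule.comap_bot]
    exact LinearMap.ker_eq_bot.2 (baseChange_injective S.toSubmodule.injective_subtype)
  isCompl_F_complexConj p q h := by
    rw [complexConj_comap_baseChange]
    exact S.isCompl p q h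

def level (S : SubHodgeStructure H) : ℕ := S.toHodgeStructure.level

end SubHodgeStructure

def pureFiltration (V : Type u) [AddCommGroup V] [Module ℚ V] (k p : ℤ) :
    Submodule ℂ (ℂ ⊗[ℚ] V) :=
  if p ≤ k then ⊤ else ⊥

theorem pureFiltration_of_le {k p : ℤ} (h : p ≤ k) : pureFiltration V k p = ⊤ := if_pos h

theorem pureFiltration_of_lt {k p : ℤ} (h : k < p) : pureFiltration V k p = ⊥ :=
  if_neg (not_le.2 h)

theorem antitone_pureFiltration (k : ℤ) : Antitone (pureFiltration V k) := by
  intro p q hpq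
  by_cases hq : q ≤ k
  · rw [pureFiltration_of_le hq, pureFiltration_of_le (hpq.trans hq)]
  · rw [pureFiltration_of_lt (not_le.1 hq)]
    exact bot_le

theorem isCompl_pureFiltration (k : ℤ) {m p q : ℤ} (hm : m = 2 * k) (h : p + q = m + 1) :
    IsCompl (pureFiltration V k p) (complexConj (pureFiltration V k q)) := by
  subst hm
  by_cases hp : p ≤ k
  · have hq : k < q := by omega
    rw [pureFiltration_of_le hp, pureFiltration_of_lt hq, complexConj_bot]
    exact isCompl_top_bot
  · have hq : q ≤ k := by omega
    rw [pureFiltration_of_lt (not_le.1 hp), pureFiltration_of_le hq, complexConj_top]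
    exact isCompl_bot_top

def pure (V : Type u) [AddCommGroup V] [Module ℚ V] (k m : ℤ) (hm : m = 2 * k) :
    HodgeStructure V m where
  F := pureFiltration V k
  antitone_F := antitone_pureFiltration k
  exists_F_eq_top := ⟨k, pureFiltration_of_le le_rfl⟩
  exists_F_eq_bot := ⟨k + 1, pureFiltration_of_lt (lt_add_one k)⟩
  isCompl_F_complexConj _ _ h := isCompl_pureFiltration k hm h

@[simp]
theorem pure_F (k m : ℤ) (hm : m = 2 * k) (p : ℤ) :
    (pure V k m hm).F p = pureFiltration V k p := rfl

def tate (j : ℤ) : HodgeStructure ℚ (-2 * j) := pure ℚ (-j) (-2 * j) (by ring)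

@[simp]
theorem tate_F (j p : ℤ) : (tate j).F p = pureFiltration ℚ (-j) p := rfl

def ofWeightZero (V : Type u) [AddCommGroup V] [Module ℚ V] : HodgeStructure V 0 :=
  pure V 0 0 (by ring)

@[simp]
theorem ofWeightZero_F (p : ℤ) : (ofWeightZero V).F p = pureFiltration V 0 p := rfl

theorem piece_pure_eq_bot {k m : ℤ} (hm : m = 2 * k) {p q : ℤ} (h : ¬(p = k ∧ q = k)) :
    (pure V k m hm).piece p q = ⊥ := by
  by_cases hpq : p + q = m
  · rw [piece_of_add_eq _ hpq, pure_F, pure_F]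
    have h' : k < p ∨ k < q := by omega
    rcases h' with h' | h'
    · rw [pureFiltration_of_lt h', bot_inf_eq]
    · rw [pureFiltration_of_lt h', complexConj_bot, inf_bot_eq]
  · exact piece_eq_bot_of_add_ne _ hpq

theorem isEffective_pure {k m : ℤ} (hm : m = 2 * k) (hk : 0 ≤ k) : (pure V k m hm).IsEffective := by
  intro p q hne
  by_contra h
  exact hne (piece_pure_eq_bot hm fun ⟨hp, hq⟩ => h ⟨hp ▸ hk, hq ▸ hk⟩)

theorem isEffective_ofWeightZero : (ofWeightZero V).IsEffective := isEffective_pure _ le_rfl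

example : (ofWeightZero V).piece (-1) (-1) = ⊥ := piece_eq_bot_of_add_ne _ (by decide)

def prodEquiv (V : Type u) [AddCommGroup V] [Module ℚ V] (W : Type v) [AddCommGroup W]
    [Module ℚ W] : ℂ ⊗[ℚ] (V × W) ≃ₗ[ℂ] (ℂ ⊗[ℚ] V) × (ℂ ⊗[ℚ] W) :=
  TensorProduct.prodRight ℚ ℂ ℂ V W

theorem conj_prodEquiv_symm (x : ℂ ⊗[ℚ] V) (y : ℂ ⊗[ℚ] W) :
    conj ((prodEquiv V W).symm (x, y)) = (prodEquiv V W).symm (conj x, conj y) := by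
  have hx : ∀ x : ℂ ⊗[ℚ] V,
      conj ((prodEquiv V W).symm (x, 0)) = (prodEquiv V W).symm (conj x, 0) := by
    intro x
    induction x using TensorProduct.induction_on with
    | zero => simp [← Prod.zero_eq_mk]
    | tmul a v =>
      have : ((a ⊗ₜ[ℚ] v, 0) : (ℂ ⊗[ℚ] V) × (ℂ ⊗[ℚ] W)) = prodEquiv V W (a ⊗ₜ (v, 0)) := by
        simp [prodEquiv]
      have h' : ((starRingEnd ℂ a ⊗ₜ[ℚ] v, 0) : (ℂ ⊗[ℚ] V) × (ℂ ⊗[ℚ] W)) =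
          prodEquiv V W (starRingEnd ℂ a ⊗ₜ (v, 0)) := by
        simp [prodEquiv]
      rw [this, LinearEquiv.symm_apply_apply, conj_tmul, conj_tmul, h', LinearEquiv.symm_apply_apply]
    | add x y hx hy =>
      have : ((x + y, 0) : (ℂ ⊗[ℚ] V) × (ℂ ⊗[ℚ] W)) = (x, 0) + (y, 0) := by simp
      rw [this, map_add, map_add, hx, hy, ← map_add, Prod.mk_add_mk, ← map_add, add_zero]
  have hy : ∀ y : ℂ ⊗[ℚ] W,
      conj ((prodEquiv V W).symm (0, y)) = (prodEquiv V W).symm (0, conj y) := by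
    intro y
    induction y using TensorProduct.induction_on with
    | zero => simp [← Prod.zero_eq_mk]
    | tmul a w =>
      have : ((0, a ⊗ₜ[ℚ] w) : (ℂ ⊗[ℚ] V) × (ℂ ⊗[ℚ] W)) = prodEquiv V W (a ⊗ₜ (0, w)) := by
        simp [prodEquiv]
      have h' : ((0, starRingEnd ℂ a ⊗ₜ[ℚ] w) : (ℂ ⊗[ℚ] V) × (ℂ ⊗[ℚ] W)) =
          prodEquiv V W (starRingEnd ℂ a ⊗ₜ (0, w)) := by
        simp [prodEquiv]
      rw [this, LinearEquiv.symm_apply_apply, conj_tmul, conj_tmul, h', LinearEquiv.symm_apply_apply]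
    | add x y hx hy =>
      have : ((0, x + y) : (ℂ ⊗[ℚ] V) × (ℂ ⊗[ℚ] W)) = (0, x) + (0, y) := by simp
      rw [this, map_add, map_add, hx, hy, ← map_add, Prod.mk_add_mk, ← map_add, add_zero]
  have : ((x, y) : (ℂ ⊗[ℚ] V) × (ℂ ⊗[ℚ] W)) = (x, 0) + (0, y) := by simp
  rw [this, map_add, map_add, hx, hy, ← map_add, Prod.mk_add_mk, add_zero, zero_add]

theorem complexConj_comap_prod (A : Submodule ℂ (ℂ ⊗[ℚ] V)) (B : Submodule ℂ (ℂ ⊗[ℚ] W)) :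
    complexConj ((A.prod B).comap (prodEquiv V W : ℂ ⊗[ℚ] (V × W) →ₗ[ℂ] _)) =
      ((complexConj A).prod (complexConj B)).comap
        (prodEquiv V W : ℂ ⊗[ℚ] (V × W) →ₗ[ℂ] _) := by
  ext z
  obtain ⟨⟨x, y⟩, rfl⟩ := (prodEquiv V W).symm.surjective z
  simp only [Submodule.mem_comap, mem_complexConj, LinearEquiv.coe_coe, conj_prodEquiv_symm,
    LinearEquiv.apply_symm_apply, Submodule.mem_prod]

def prod (H₁ : HodgeStructure V n) (H₂ : HodgeStructure W n) : HodgeStructure (V × W) n where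
  F p := ((H₁.F p).prod (H₂.F p)).comap (prodEquiv V W : ℂ ⊗[ℚ] (V × W) →ₗ[ℂ] _)
  antitone_F _ _ h :=
    Submodule.comap_mono (Submodule.prod_mono (H₁.antitone_F h) (H₂.antitone_F h))
  exists_F_eq_top := by
    obtain ⟨p₁, h₁⟩ := H₁.exists_F_eq_top
    obtain ⟨p₂, h₂⟩ := H₂.exists_F_eq_top
    refine ⟨min p₁ p₂, ?_⟩
    have e₁ : H₁.F (min p₁ p₂) = ⊤ := eq_top_iff.2 (h₁ ▸ H₁.antitone_F (min_le_left _ _))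
    have e₂ : H₂.F (min p₁ p₂) = ⊤ := eq_top_iff.2 (h₂ ▸ H₂.antitone_F (min_le_right _ _))
    rw [e₁, e₂, Submodule.prod_top, Submodule.comap_top]
  exists_F_eq_bot := by
    obtain ⟨p₁, h₁⟩ := H₁.exists_F_eq_bot
    obtain ⟨p₂, h₂⟩ := H₂.exists_F_eq_bot
    refine ⟨max p₁ p₂, ?_⟩
    have e₁ : H₁.F (max p₁ p₂) = ⊥ := eq_bot_iff.2 (h₁ ▸ H₁.antitone_F (le_max_left _ _))
    have e₂ : H₂.F (max p₁ p₂) = ⊥ := eq_bot_iff.2 (h₂ ▸ H₂.antitone_F (le_max_right _ _))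
    rw [e₁, e₂, Submodule.prod_bot, Submodule.comap_bot]
    exact LinearEquiv.ker _
  isCompl_F_complexConj p q h := by
    rw [complexConj_comap_prod]
    refine ((Submodule.orderIsoMapComap (prodEquiv V W)).symm.isCompl_iff).1 ?_
    obtain ⟨hinf, hsup⟩ := H₁.isCompl_F_complexConj p q h
    obtain ⟨hinf', hsup'⟩ := H₂.isCompl_F_complexConj p q h
    refine ⟨?_, ?_⟩
    · rw [disjoint_iff] at hinf hinf' ⊢
      rw [Submodule.prod_inf_prod, hinf, hinf', Submodule.prod_bot]
    · rw [codisjoint_iff] at hsup hsup' ⊢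
      rw [Submodule.prod_sup_prod, hsup, hsup', Submodule.prod_top]

structure Polarization (H : HodgeStructure V n) where

  form : LinearMap.BilinForm ℚ V

  flip_form : form.flip = ((n.negOnePow : ℤˣ) : ℤ) • form

  form_apply_eq_zero : ∀ p : ℤ, ∀ x ∈ H.F p, ∀ y ∈ H.F (n + 1 - p), form.baseChange ℂ x y = 0

  pos : ∀ p q : ℤ, p + q = n → ∀ x ∈ H.piece p q, x ≠ 0 →
    ∃ r : ℝ, 0 < r ∧ Complex.I ^ p * (Complex.I ^ q)⁻¹ * form.baseChange ℂ x (conj x) = r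

def IsPolarizable (H : HodgeStructure V n) : Prop := Nonempty (Polarization H)

private theorem eq_rid_tmul_one (x : ℂ ⊗[ℚ] ℚ) : x = (TensorProduct.rid ℚ ℂ x) ⊗ₜ[ℚ] (1 : ℚ) := by
  conv_lhs => rw [← (TensorProduct.rid ℚ ℂ).symm_apply_apply x]
  rfl

theorem eq_of_mem_piece_tate {j p q : ℤ} (hpq : p + q = -2 * j) {x : ℂ ⊗[ℚ] ℚ}
    (hx : x ∈ (tate j).piece p q) (hx0 : x ≠ 0) : p = -j ∧ q = -j := by
  rw [mem_piece_iff _ hpq] at hx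
  by_contra hne
  have h : -j < p ∨ -j < q := by omega
  apply hx0
  rcases h with h | h
  · have : x ∈ (tate j).F p := hx.1
    rwa [tate_F, pureFiltration_of_lt h, Submodule.mem_bot] at this
  · have : x ∈ complexConj ((tate j).F q) := hx.2
    rwa [tate_F, pureFiltration_of_lt h, complexConj_bot, Submodule.mem_bot] at this

def Polarization.tate (j : ℤ) : Polarization (tate j) where
  form := LinearMap.mul ℚ ℚ
  flip_form := by
    have : (-2 * j).negOnePow = 1 := by
      rw [neg_mul, Int.negOnePow_neg, Int.negOnePow_two_mul]
    rw [this, Units.val_one, one_smul]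
    ext
    simp
  form_apply_eq_zero p x hx y hy := by
    by_cases hp : p ≤ -j
    · have hq : -j < -2 * j + 1 - p := by omega
      rw [tate_F, pureFiltration_of_lt hq, Submodule.mem_bot] at hy
      simp [hy]
    · rw [tate_F, pureFiltration_of_lt (not_le.1 hp), Submodule.mem_bot] at hx
      simp [hx]
  pos p q hpq x hx hx0 := by
    obtain ⟨rfl, rfl⟩ := eq_of_mem_piece_tate hpq hx hx0
    set c : ℂ := TensorProduct.rid ℚ ℂ x with hc
    have hxc : x = c ⊗ₜ[ℚ] (1 : ℚ) := eq_rid_tmul_one x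
    have hc0 : c ≠ 0 := by
      rintro h0
      exact hx0 (by rw [hxc, h0, TensorProduct.zero_tmul])
    refine ⟨Complex.normSq c, Complex.normSq_pos.2 hc0, ?_⟩
    rw [mul_inv_cancel₀ (zpow_ne_zero _ Complex.I_ne_zero), one_mul, hxc, conj_tmul,
      LinearMap.BilinForm.baseChange_tmul]
    simp [Complex.mul_conj]

theorem isPolarizable_tate (j : ℤ) : IsPolarizable (tate j) := ⟨Polarization.tate j⟩

end HodgeStructure

end HostAPI.Carriers.AlgebraicGeometry.Motives

end
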